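import Summits.AtomisticToContinuum.Crystallization.Theses.VdwKissingSutherland

/-!
# `SutherlandBound` (stmt-AtomisticToContinuum-3268): reduction to the one-centre bound

The item `SutherlandBound` of route `VdwKissingSutherland` (shared verbatim with routes
`HcpThetaUniversality` and the retired `MieLadderVdwKissing`) says: for every `N`-point unit packing
`x` of `ℝ³`, `Σ_i Σ_j |x_i − x_j|⁻⁶ ≤ N · L₆(hcp)` with
`L₆(hcp) = ∑' y ∈ hcpStacking 1 √(2/3), ‖y‖⁻⁶` (diagonal terms are `0⁻¹ = 0`).

This file records the elementary bookkeeping around the item: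

* `sum_inv_dist_pow_six_eq_sum_image` — the site sum of centre `i` is the one-centre sum
  `Σ_{y ∈ X_i} ‖y‖⁻⁶` over the finset `X_i = {x_j − x_i : j ≠ i}` (a finite unit packing of the
  exterior of the unit ball);
* `sutherlandBound_of_oneCentre` — the pointwise ONE-CENTRE bound (for every finite `X ⊂ ℝ³` with
  `‖y‖ ≥ 1` and pairwise distances `≥ 1`, `Σ_{y ∈ X} ‖y‖⁻⁶ ≤ L₆(hcp)`; this is verbatim the decl
  `MieLadderVdwKissing.VdwOneCentre`, g1 item 3265) implies `SutherlandBound` by summing over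
  centres — the "corollary of VdwOneCentre" reading in the item's docstring;
* `sutherlandBound_of_siteBound` — more generally any uniform bound `C` on the site sums with
  `C ≤ L₆(hcp)` gives the item.

[folklore]
-/

noncomputable section

namespace Summit.AtomisticToContinuum.Crystallization.Theorems

open Literature.MathematicalPhysics.StatisticalMechanics

/-- **Site sum = one-centre sum.** For a configuration with pairwise distances `≥ 1` (hence
injective) the `r⁻⁶` site sum of centre `i` (diagonal term `0⁻¹ ^ 6 = 0` included) equals the sum
of `‖y‖⁻⁶` over the finset of relative positions `{x_j − x_i : j ≠ i}`. [folklore] -/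
theorem sum_inv_dist_pow_six_eq_sum_image {N : ℕ} (x : Fin N → EuclideanSpace ℝ (Fin 3))
    (hsep : ∀ i j, i ≠ j → 1 ≤ dist (x i) (x j)) (i : Fin N) :
    ∑ j, (dist (x i) (x j))⁻¹ ^ 6 =
      ∑ y ∈ (Finset.univ.erase i).image (fun j => x j - x i), ‖y‖⁻¹ ^ 6 := by
  have hinj : Set.InjOn (fun j => x j - x i) ↑(Finset.univ.erase i) := by
    intro j _ j' _ h
    by_contra hne
    have h1 := hsep j j' hne
    have h2 : x j = x j' := sub_left_injective h
    rw [h2, dist_self] at h1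
    exact absurd h1 (by norm_num)
  rw [Finset.sum_image hinj, ← Finset.add_sum_erase _ _ (Finset.mem_univ i), dist_self, inv_zero,
    zero_pow (by norm_num), zero_add]
  refine Finset.sum_congr rfl fun j _ => ?_
  rw [dist_eq_norm, ← norm_neg, neg_sub]

/-- **Uniform site bounds sum to the item.** If every site sum of every finite unit packing is at
most `C` and `C ≤ L₆(hcp)`, then `SutherlandBound` holds. [folklore] -/
theorem sutherlandBound_of_siteBound (C : ℝ)
    (hC : C ≤ ∑' y : ↥(hcpStacking 1 (Real.sqrt (2 / 3))), ‖(y : EuclideanSpace ℝ (Fin 3))‖⁻¹ ^ 6)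
    (hsite : ∀ (N : ℕ) (x : Fin N → EuclideanSpace ℝ (Fin 3)),
      (∀ i j, i ≠ j → 1 ≤ dist (x i) (x j)) → ∀ i, ∑ j, (dist (x i) (x j))⁻¹ ^ 6 ≤ C) :
    Theses.VdwKissingSutherland.SutherlandBound := by
  intro N x hsep
  calc ∑ i, ∑ j, (dist (x i) (x j))⁻¹ ^ 6
      ≤ ∑ _i : Fin N, ∑' y : ↥(hcpStacking 1 (Real.sqrt (2 / 3))),
          ‖(y : EuclideanSpace ℝ (Fin 3))‖⁻¹ ^ 6 :=
        Finset.sum_le_sum fun i _ => (hsite N x hsep i).trans hC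
    _ = (N : ℝ) * ∑' y : ↥(hcpStacking 1 (Real.sqrt (2 / 3))),
          ‖(y : EuclideanSpace ℝ (Fin 3))‖⁻¹ ^ 6 := by
        rw [Finset.sum_const, Finset.card_univ, Fintype.card_fin, nsmul_eq_mul]

/-- **`VdwOneCentre → SutherlandBound`.** The pointwise one-centre van der Waals bound — for every
finite `X ⊂ ℝ³` with `‖y‖ ≥ 1` on `X` and pairwise distances `≥ 1`,
`Σ_{y ∈ X} ‖y‖⁻⁶ ≤ L₆(hcp)` (verbatim `MieLadderVdwKissing.VdwOneCentre`, item
stmt-AtomisticToContinuum-3265) — implies the item by summing over centres: the relative positions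
`{x_j − x_i : j ≠ i}` of a unit packing form such an `X`. [folklore] -/
theorem sutherlandBound_of_oneCentre
    (h1c : ∀ X : Finset (EuclideanSpace ℝ (Fin 3)), (∀ x ∈ X, 1 ≤ ‖x‖) →
      (∀ x ∈ X, ∀ y ∈ X, x ≠ y → 1 ≤ dist x y) →
      ∑ x ∈ X, ‖x‖⁻¹ ^ 6 ≤
        ∑' y : ↥(hcpStacking 1 (Real.sqrt (2 / 3))), ‖(y : EuclideanSpace ℝ (Fin 3))‖⁻¹ ^ 6) :
    Theses.VdwKissingSutherland.SutherlandBound := by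
  refine sutherlandBound_of_siteBound _ le_rfl fun N x hsep i => ?_
  rw [sum_inv_dist_pow_six_eq_sum_image x hsep i]
  refine h1c _ (fun y hy => ?_) (fun y hy z hz hyz => ?_)
  · obtain ⟨j, hj, rfl⟩ := Finset.mem_image.1 hy
    have := hsep j i (Finset.ne_of_mem_erase hj)
    rwa [dist_eq_norm] at this
  · obtain ⟨j, hj, rfl⟩ := Finset.mem_image.1 hy
    obtain ⟨j', hj', rfl⟩ := Finset.mem_image.1 hz
    have hne : j ≠ j' := fun h => hyz (by rw [h])
    have := hsep j j' hne
    rwa [dist_sub_right]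

end Summit.AtomisticToContinuum.Crystallization.Theorems
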